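import Summits.KontsevichZagierPeriods.KontsevichZagierPeriods.Theorems.SoloInformedAlgReduce
import HarnessLib

/-!
# THEOREM 2D⁺ — every bivariate denominator is presentable

Solo programme `solo-KontsevichZagierPeriods-informed`, session s108, step 6 (final) of
THEOREM 2D⁺: the kernel rung `n = 2` of the cube crux WITHOUT any hypothesis on the denominator.

**THEOREM 2D⁺** (`soloInformed_presentableDenK_dim2_all`).  Let `K ⊆ ℝ` be a field of real
algebraic numbers containing every real algebraic root of its non-zero polynomials (e.g. `K = 𝔸_ℝ`,
`soloInformed_presentableDenK_dim2_all_algebraicClosure`).  Then EVERY `Q ∈ K[x₀, x₁]` is a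
presentable denominator: for every `P ∈ K[x₀, x₁]` and every `IntegralRep` `r` with
`(0,1)² ⊆ dom r ⊆ [0,1]²` whose integrand agrees with the (junk-valued) quotient `P/Q` on `(0,1)²`,
`k • of r − ∑ⱼ cⱼ • of ρⱼ ∈ KZ.relations` with `k ≥ 1`, `cⱼ ∈ ℤ` and `ρⱼ` cube integrals of real
parts of cube germs (`soloInformedPresentable`).

Proof (GLUE).  Absolute convergence of `r` makes `P/Q` integrable on `U = (0,1)²`; RED
(`soloInformed_reduce_dim2`) gives `P/Q = P₁/Q₁` off the null zero set of some `N ≠ 0`, with `Q₁`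
having finitely many zeros on `U`.  Inside `KZ.relations`: `r ∼ r|_U ∼ r|_V` with
`V = U ∖ {N = 0}` (null differences, `IntegralRep.of_sub_of_restrict_mem_relations`),
`r|_V ∼ ρ|_V ∼ ρ` for `ρ = ∫_U P₁/Q₁` (congruence of integrands on `V`), and `ρ` is presentable by
THEOREM FIN (`soloInformed_presentableDenK_of_finite_zeros`).

Corollary (`soloInformed_cubeResolution_dim2_all`): the cube crux holds for every rational
integrand `P/Q`, `P, Q ∈ 𝔸_ℝ[x₀, x₁]`, on the closed square — no non-vanishing, no finiteness, no
nondegeneracy hypothesis.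

References: Kontsevich–Zagier 2001 §1.1–1.2; Bochnak–Coste–Roy 1998 §1.2, §2.
-/

noncomputable section

open scoped BigOperators
open MeasureTheory Set Filter
open Literature.NumberTheory.Transcendental Literature.NumberTheory.Transcendental.KZ

namespace Summit.KontsevichZagierPeriods.KontsevichZagierPeriods.Theorems

variable {K : Type*} [Field K] [Algebra K ℝ]

/-- **GLUE.**  If `P/Q = P₁/Q₁` off the zero set of `N ≠ 0` and `Q₁` is a presentable denominator,
then every legal representation of `P/Q` is presentable. [this work] -/
theorem soloInformed_presentable_of_eq_off_null
    (hK : ∀ c : K, IsAlgebraic ℚ (algebraMap K ℝ c)) {P Q P₁ Q₁ N : MvPolynomial (Fin 2) K}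
    (hN : N ≠ 0)
    (hval : ∀ x : Fin 2 → ℝ, (MvPolynomial.aeval x N : ℝ) ≠ 0 →
      (MvPolynomial.aeval x P : ℝ) / MvPolynomial.aeval x Q =
        MvPolynomial.aeval x P₁ / MvPolynomial.aeval x Q₁)
    (hQ₁ : SoloInformedPresentableDenK Q₁) (r : IntegralRep 2)
    (hr₁ : soloInformedOpenCube 2 ⊆ r.domain) (hr₂ : r.domain ⊆ soloInformedCube 2)
    (hri : EqOn r.integrand
      (fun x => (MvPolynomial.aeval x P : ℝ) / MvPolynomial.aeval x Q) (soloInformedOpenCube 2)) :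
    of r ∈ soloInformedPresentable := by
  have hmeas : MeasurableSet (soloInformedOpenCube 2) := by
    rw [soloInformedOpenCube_eq_pi]; exact MeasurableSet.univ_pi fun _ => measurableSet_Ioo
  have hUsa := isSemialgebraic_soloInformedOpenCube 2
  -- integrability of `P/Q` and of `P₁/Q₁` on the open square
  have hint : IntegrableOn (fun x => (MvPolynomial.aeval x P : ℝ) / MvPolynomial.aeval x Q)
      (soloInformedOpenCube 2) :=
    (r.integrableOn.mono_set hr₁).congr_fun hri hmeas
  have hnull := soloInformed_volume_zeroSet_openCube hN
  have hae : (fun x => (MvPolynomial.aeval x P : ℝ) / MvPolynomial.aeval x Q) =ᵐ[volume.restrict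
      (soloInformedOpenCube 2)]
      (fun x => (MvPolynomial.aeval x P₁ : ℝ) / MvPolynomial.aeval x Q₁) := by
    rw [Filter.EventuallyEq, ae_restrict_iff' hmeas, ae_iff]
    refine measure_mono_null (fun x hx => ?_) hnull
    rw [mem_setOf_eq, Classical.not_imp] at hx
    obtain ⟨hxU, hne⟩ := hx
    refine ⟨hxU, ?_⟩
    by_contra hNx
    exact hne (hval x hNx)
  have hint₁ : IntegrableOn (fun x => (MvPolynomial.aeval x P₁ : ℝ) / MvPolynomial.aeval x Q₁)
      (soloInformedOpenCube 2) := hint.congr_fun_ae hae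
  -- the good set `V`
  set V : Set (Fin 2 → ℝ) := soloInformedOpenCube 2 \
    {x | x ∈ soloInformedOpenCube 2 ∧ (MvPolynomial.aeval x N : ℝ) = 0} with hV
  have hVsa : Literature.ModelTheory.ExponentialFields.IsSemialgebraic ℚ V := hUsa.diff (soloInformed_isSemialgebraic_zeroSetK hK N)
  have hVU : V ⊆ soloInformedOpenCube 2 := sdiff_subset
  have hUV : volume (soloInformedOpenCube 2 \ V) = 0 :=
    measure_mono_null (fun x hx => by
      by_contra h
      exact hx.2 ⟨hx.1, h⟩) hnull
  have hVN : ∀ x ∈ V, (MvPolynomial.aeval x N : ℝ) ≠ 0 := fun x hx h => hx.2 ⟨hx.1, h⟩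
  -- `r ∼ r|_U ∼ r|_V`
  set r₀ := r.restrict (soloInformedOpenCube 2) hUsa hr₁ with hr₀
  have h₀ : of r - of r₀ ∈ relations :=
    r.of_sub_of_restrict_mem_relations hUsa hr₁
      (measure_mono_null (fun x (hx : x ∈ r.domain \ soloInformedOpenCube 2) =>
        show x ∈ soloInformedCube 2 \ soloInformedOpenCube 2 from ⟨hr₂ hx.1, hx.2⟩)
        (soloInformed_volume_cube_diff_openCube 2))
  have hVr₀ : V ⊆ r₀.domain := hVU
  have h₁ : of r₀ - of (r₀.restrict V hVsa hVr₀) ∈ relations :=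
    r₀.of_sub_of_restrict_mem_relations hVsa hVr₀ hUV
  -- `ρ = ∫_U P₁/Q₁ ∼ ρ|_V`
  set ρ := soloInformedOfRationalK₀ hK (soloInformedOpenCube 2) P₁ Q₁ hUsa hint₁ with hρ
  have hVρ : V ⊆ ρ.domain := hVU
  have h₂ : of ρ - of (ρ.restrict V hVsa hVρ) ∈ relations :=
    ρ.of_sub_of_restrict_mem_relations hVsa hVρ hUV
  -- `r|_V ∼ ρ|_V`
  have h₃ : of (r₀.restrict V hVsa hVr₀) - of (ρ.restrict V hVsa hVρ) ∈ relations :=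
    of_sub_of_mem_relations_of_eqOn rfl fun x hx => by
      simp only [IntegralRep.integrand_restrict, hρ, soloInformedOfRationalK₀_integrand, hr₀]
      rw [hri (hVU hx)]
      exact hval x (hVN x hx)
  -- `ρ` is presentable by hypothesis on `Q₁`
  have hρP : of ρ ∈ soloInformedPresentable :=
    hQ₁ P₁ ρ subset_rfl (soloInformedOpenCube_subset_cube 2) fun x _ => rfl
  have hrel : of r - of ρ ∈ relations := by
    have : of r - of ρ = (of r - of r₀) + (of r₀ - of (r₀.restrict V hVsa hVr₀)) +
        (of (r₀.restrict V hVsa hVr₀) - of (ρ.restrict V hVsa hVρ)) -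
        (of ρ - of (ρ.restrict V hVsa hVρ)) := by abel
    rw [this]
    exact relations.sub_mem (relations.add_mem (relations.add_mem h₀ h₁) h₃) h₂
  exact soloInformed_presentable_of_sub_mem hrel hρP

/-- **THEOREM 2D⁺.**  Over a field `K` of real algebraic numbers closed under real algebraic roots,
EVERY `Q ∈ K[x₀, x₁]` is a presentable denominator — no hypothesis on the zeros of `Q`.
[this work] -/
theorem soloInformed_presentableDenK_dim2_all
    (hK : ∀ c : K, IsAlgebraic ℚ (algebraMap K ℝ c)) (hKrc : SoloInformedRealRootClosed K)
    (Q : MvPolynomial (Fin 2) K) : SoloInformedPresentableDenK Q := by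
  intro P r hr₁ hr₂ hri
  have hmeas : MeasurableSet (soloInformedOpenCube 2) := by
    rw [soloInformedOpenCube_eq_pi]; exact MeasurableSet.univ_pi fun _ => measurableSet_Ioo
  have hint : IntegrableOn (fun x => (MvPolynomial.aeval x P : ℝ) / MvPolynomial.aeval x Q)
      (soloInformedOpenCube 2) :=
    (r.integrableOn.mono_set hr₁).congr_fun hri hmeas
  obtain ⟨P₁, Q₁, N, hN, hval, hfin⟩ := soloInformed_reduce_dim2 P Q hint
  exact soloInformed_presentable_of_eq_off_null hK hN hval
    (soloInformed_presentableDenK_of_finite_zeros hK hKrc Q₁ hfin) r hr₁ hr₂ hri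

/-- **THEOREM 2D⁺ over the real algebraic numbers.**  Every `Q ∈ 𝔸_ℝ[x₀, x₁]` is a presentable
denominator. [this work] -/
theorem soloInformed_presentableDenK_dim2_all_algebraicClosure
    (Q : MvPolynomial (Fin 2) (algebraicClosure ℚ ℝ)) : SoloInformedPresentableDenK Q :=
  soloInformed_presentableDenK_dim2_all soloInformed_algCoeff_algebraicClosure
    soloInformed_realRootClosed_algebraicClosure Q

/-- **THEOREM 2D⁺, sandwich domains.**  Every `IntegralRep` with `(0,1)² ⊆ dom ⊆ [0,1]²` whose
integrand is a quotient `P/Q` of polynomials with real algebraic coefficients on `(0,1)²` is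
presentable. [this work] -/
theorem soloInformed_presentable_rational_dim2_all
    (P Q : MvPolynomial (Fin 2) (algebraicClosure ℚ ℝ)) (r : IntegralRep 2)
    (hr₁ : soloInformedOpenCube 2 ⊆ r.domain) (hr₂ : r.domain ⊆ soloInformedCube 2)
    (hri : EqOn r.integrand
      (fun x => (MvPolynomial.aeval x P : ℝ) / MvPolynomial.aeval x Q) (soloInformedOpenCube 2)) :
    of r ∈ soloInformedPresentable :=
  soloInformed_presentableDenK_dim2_all_algebraicClosure Q P r hr₁ hr₂ hri

/-- **The cube crux in dimension two, unconditionally.**  For all `P, Q ∈ 𝔸_ℝ[x₀, x₁]`: every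
`IntegralRep` on `[0,1]²` whose integrand is `P/Q` on the open square admits the resolution
`k • of r − ∑ⱼ cⱼ • of ρⱼ ∈ relations`, `k ≥ 1`, with `ρⱼ` cube integrals of real parts of cube
germs. [this work] -/
theorem soloInformed_cubeResolution_dim2_all (P Q : MvPolynomial (Fin 2) (algebraicClosure ℚ ℝ))
    (r : IntegralRep 2) (hr : r.domain = soloInformedCube 2)
    (hri : EqOn r.integrand
      (fun x => (MvPolynomial.aeval x P : ℝ) / MvPolynomial.aeval x Q) (soloInformedOpenCube 2)) :
    ∃ (k : ℕ) (_ : k ≠ 0) (m' : ℕ) (d : Fin m' → ℕ) (G : ∀ j, SoloInformedCubeGerm (d j))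
      (c : Fin m' → ℤ) (ρ : ∀ j, IntegralRep (d j)),
      (∀ j, (ρ j).domain = soloInformedCube (d j)) ∧
      (∀ j, EqOn (ρ j).integrand (fun x => ((G j).g (soloInformedToC (d j) x)).re)
        (soloInformedCube (d j))) ∧
      k • of r - ∑ j, c j • of (ρ j) ∈ relations :=
  soloInformed_cubeResolution_of_presentableDenK
    (soloInformed_presentableDenK_dim2_all_algebraicClosure Q) P r hr hri

end Summit.KontsevichZagierPeriods.KontsevichZagierPeriods.Theorems
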